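import Mathlib
import Summits.ValiantsHypothesis.ValiantsHypothesis.Theorems.FreeSubtorusOrbitDimensionBoundStubAbsorbingSacrificeRigidCoefficients
import HarnessLib

/-!
# Route FreeSubtorus — crux `OrbitDimensionBound` (stmt-ValiantsHypothesis-16133), line `affine_multiple`,
# stub 2 `stub_absorbingSacrifice`, case split (3a)(i): RE-MATCH OR RIGID

Registered line `Cruxes/OrbitDimensionBound/Lines/affine_multiple.lean`, card branch (c) (l.120–127):

  «(c) otherwise a position `(ι_j, l)` of `supp q` with `l` free … is either re-matched (`M − (ι_j,κ_j) + (ι_j,l)`,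
  or `M − (ι_j,κ_j) + (k'',l'') + (ι_j,l)`, spanning iff `[a_{ι_j}] ≠ [b_l]` resp. `[a_{k''}] ≠ [b_{l''}]` in
  `W / span(M ∖ j) ≅ ℚ`), or — when all of these fail … — the variable `x_{(ι_j,l)}` is replaced by a generic CONSTANT»

This file is the combinatorial heart of that case split, in the abstract `ℚ`-currency of
`…StubAbsorbingSacrificeRigidCoefficients.lean` (matched differences `D : Fin s → V` linearly independent, free row
vectors `a k`, free column vectors `b l`, pair `j₀ = (A₀, B₀)`):

* `linearIndependent_update_of_not_mem_span` — RE-MATCHING: replacing `D j₀` by a vector OUTSIDE the span of the other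
  differences keeps the family independent («spanning iff `[·] ≠ [·]` in `W / span(M ∖ j₀)`»), and
  `mem_span_range_update` — `D j₀` (hence all of `W`) stays in the span of the re-matched family;
* `rematch_or_rigid` — THE TRICHOTOMY at a position `(ι_{j₀}, l₀)`: (i) re-match pair `j₀` to `(ι_{j₀}, l₀)` (the
  position lands on the new matched diagonal, card case (b)), or (ii) re-match pair `j₀` to some `(k, l)`, `l ≠ l₀`,
  or `(k, κ_{j₀})` (row `ι_{j₀}` and column `l₀` become free, the position lands in the free block, card case (a)),
  or (iii) the rigid configuration `hrigid` = (R1) ∧ (R2) ∧ (R3);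
* `rematch_or_constant_coefficients` — with `rigid_coefficients_of_mem_span`: re-match, or the `j₀`-coefficients are
  constant (`ar k j₀ = α`, `ac l j₀ = α` for `l ≠ l₀`, `ac l₀ j₀ = α + N`), i.e. the pinned character is
  `(∏ d' ∏ e')^α = 1 ⊇ T¹`.

What remains of stub 2 after this file: the COMPOSITION (card steps: relabel / maximum independent matching / cofactor
shape / this trichotomy / pin algebra p579596 / lifts p580173 / extension p581884 / `exists_roots_prod_eq_one`).

Honest framing: helper inside a registered stub of an OPEN crux on a conditional route; `stub_absorbingSacrifice`, the
crux and VP ≠ VNP are NOT proved; census-neutral.  No definitions, no named facts.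
-/

set_option linter.dupNamespace false

noncomputable section

open scoped BigOperators

namespace Summit.ValiantsHypothesis.ValiantsHypothesis.Theorems.FreeSubtorusOrbitDimensionBound.AbsorbingSacrifice

variable {V : Type*} [AddCommGroup V] [Module ℚ V] {s : ℕ}

/-! ### Re-matching one pair -/

/-- Splitting a sum over `Fin s` at `j₀` for an updated family. [folklore] -/
theorem sum_smul_update (D : Fin s → V) (j₀ : Fin s) (v : V) (g : Fin s → ℚ) :
    ∑ j, g j • Function.update D j₀ v j = g j₀ • v + ∑ j ∈ Finset.univ.erase j₀, g j • D j := by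
  classical
  rw [← Finset.add_sum_erase Finset.univ _ (Finset.mem_univ j₀), Function.update_self]
  congr 1
  refine Finset.sum_congr rfl fun j hj => ?_
  rw [Function.update_of_ne (Finset.ne_of_mem_erase hj)]

/-- A sum over `j ≠ j₀` of multiples of the `D j` lies in the span of `{D j : j ≠ j₀}`. [folklore] -/
theorem sum_erase_mem_span (D : Fin s → V) (j₀ : Fin s) (g : Fin s → ℚ) :
    ∑ j ∈ Finset.univ.erase j₀, g j • D j ∈ Submodule.span ℚ (D '' {j | j ≠ j₀}) := by
  refine Submodule.sum_mem _ fun j hj => Submodule.smul_mem _ _ (Submodule.subset_span ?_)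
  exact ⟨j, Finset.ne_of_mem_erase hj, rfl⟩

/-- **Re-matching keeps independence.** If the new difference `v` does NOT lie in the span of the other matched
differences, the family with `D j₀` replaced by `v` is linearly independent («spanning iff `[·] ≠ [·]` in
`W / span(M ∖ j₀)`»). [folklore] -/
theorem linearIndependent_update_of_not_mem_span {D : Fin s → V} (hw : LinearIndependent ℚ D) (j₀ : Fin s)
    {v : V} (hv : v ∉ Submodule.span ℚ (D '' {j | j ≠ j₀})) :
    LinearIndependent ℚ (Function.update D j₀ v) := by
  classical
  rw [Fintype.linearIndependent_iff]
  intro g hg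
  rw [sum_smul_update] at hg
  -- the coefficient of `v` vanishes, else `v` would lie in the span of the others
  have hg₀ : g j₀ = 0 := by
    by_contra hne
    apply hv
    have hv' : v = (-(g j₀)⁻¹) • ∑ j ∈ Finset.univ.erase j₀, g j • D j := by
      have : g j₀ • v = -∑ j ∈ Finset.univ.erase j₀, g j • D j := eq_neg_of_add_eq_zero_left hg
      rw [neg_smul, ← smul_neg, ← this, smul_smul, inv_mul_cancel₀ hne, one_smul]
    rw [hv']
    exact Submodule.smul_mem _ _ (sum_erase_mem_span D j₀ g)
  -- then the remaining relation is among the `D j`, `j ≠ j₀`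
  rw [hg₀, zero_smul, zero_add] at hg
  have hrel : ∑ j, (if j = j₀ then 0 else g j) • D j = 0 := by
    rw [← Finset.add_sum_erase Finset.univ _ (Finset.mem_univ j₀), if_pos rfl, zero_smul, zero_add, ← hg]
    exact Finset.sum_congr rfl fun j hj => by rw [if_neg (Finset.ne_of_mem_erase hj)]
  intro j
  by_cases hj : j = j₀
  · rw [hj]; exact hg₀
  · have := Fintype.linearIndependent_iff.1 hw (fun j => if j = j₀ then 0 else g j) hrel j
    simpa [hj] using this

/-- **Re-matching keeps the span.** If `v = Σ c_j D_j` with `c_{j₀} ≠ 0` — which is the case whenever `v ∈ W = span D`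
lies outside the span of the other differences — then `D j₀` lies in the span of the re-matched family (so the
re-matched family spans `W` again). [folklore] -/
theorem mem_span_range_update {D : Fin s → V} (j₀ : Fin s) {v : V} {c : Fin s → ℚ} (hc : c j₀ ≠ 0)
    (hv : v = ∑ j, c j • D j) : D j₀ ∈ Submodule.span ℚ (Set.range (Function.update D j₀ v)) := by
  classical
  -- `D j₀ = c_{j₀}⁻¹ • (v − Σ_{j ≠ j₀} c_j D_j)`
  have hsplit : v = c j₀ • D j₀ + ∑ j ∈ Finset.univ.erase j₀, c j • D j := by
    rw [hv, ← Finset.add_sum_erase Finset.univ _ (Finset.mem_univ j₀)]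
  have hD : D j₀ = (c j₀)⁻¹ • (v - ∑ j ∈ Finset.univ.erase j₀, c j • D j) := by
    rw [hsplit, add_sub_cancel_right, smul_smul, inv_mul_cancel₀ hc, one_smul]
  rw [hD]
  refine Submodule.smul_mem _ _ (Submodule.sub_mem _ (Submodule.subset_span ⟨j₀, Function.update_self ..⟩) ?_)
  refine Submodule.sum_mem _ fun j hj => Submodule.smul_mem _ _ (Submodule.subset_span ⟨j, ?_⟩)
  rw [Function.update_of_ne (Finset.ne_of_mem_erase hj)]

/-- A vector of `W = span D` outside the span of the other differences has a non-zero `j₀`-coefficient. [folklore] -/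
theorem exists_coeffs_ne_zero_of_not_mem_span {D : Fin s → V} (j₀ : Fin s) {v : V}
    (hvW : v ∈ Submodule.span ℚ (Set.range D)) (hv : v ∉ Submodule.span ℚ (D '' {j | j ≠ j₀})) :
    ∃ c : Fin s → ℚ, c j₀ ≠ 0 ∧ v = ∑ j, c j • D j := by
  classical
  rw [Finsupp.mem_span_range_iff_exists_finsupp] at hvW
  obtain ⟨l, hl⟩ := hvW
  refine ⟨l, ?_, ?_⟩
  · intro h0
    apply hv
    rw [← hl, Finsupp.sum_fintype _ _ (fun j => zero_smul ℚ (D j)),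
      ← Finset.add_sum_erase Finset.univ _ (Finset.mem_univ j₀), h0, zero_smul, zero_add]
    exact sum_erase_mem_span D j₀ l
  · rw [← hl, Finsupp.sum_fintype _ _ (fun j => zero_smul ℚ (D j))]

/-! ### The trichotomy at a position `(ι_{j₀}, l₀)` -/

/-- **RE-MATCH OR RIGID** (card branch (c), the case split (3a)(i)): at the position `(ι_{j₀}, l₀)` either
(i) re-matching pair `j₀` to `(ι_{j₀}, l₀)` keeps an independent matching, or (ii) re-matching pair `j₀` to some
`(k, l)` with `l ≠ l₀` or to `(k, κ_{j₀})` does (and the position falls into the free block), or (iii) all re-matchings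
fail: the rigid configuration (R1) ∧ (R2) ∧ (R3). [folklore] -/
theorem rematch_or_rigid {n' : ℕ} (D : Fin s → V) (hw : LinearIndependent ℚ D) (a b : Fin n' → V) (A₀ B₀ : V)
    (j₀ : Fin s) (l₀ : Fin n') :
    LinearIndependent ℚ (Function.update D j₀ (A₀ - b l₀)) ∨
    (∃ k l, l ≠ l₀ ∧ LinearIndependent ℚ (Function.update D j₀ (a k - b l))) ∨
    (∃ k, LinearIndependent ℚ (Function.update D j₀ (a k - B₀))) ∨
    ((A₀ - b l₀ ∈ Submodule.span ℚ (D '' {j | j ≠ j₀})) ∧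
      (∀ k l, l ≠ l₀ → a k - b l ∈ Submodule.span ℚ (D '' {j | j ≠ j₀})) ∧
      (∀ k, a k - B₀ ∈ Submodule.span ℚ (D '' {j | j ≠ j₀}))) := by
  classical
  by_cases h1 : A₀ - b l₀ ∈ Submodule.span ℚ (D '' {j | j ≠ j₀})
  · by_cases h2 : ∀ k l, l ≠ l₀ → a k - b l ∈ Submodule.span ℚ (D '' {j | j ≠ j₀})
    · by_cases h3 : ∀ k, a k - B₀ ∈ Submodule.span ℚ (D '' {j | j ≠ j₀})
      · exact Or.inr (Or.inr (Or.inr ⟨h1, h2, h3⟩))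
      · push Not at h3
        obtain ⟨k, hk⟩ := h3
        exact Or.inr (Or.inr (Or.inl ⟨k, linearIndependent_update_of_not_mem_span hw j₀ hk⟩))
    · push Not at h2
      obtain ⟨k, l, hl, hkl⟩ := h2
      exact Or.inr (Or.inl ⟨k, l, hl, linearIndependent_update_of_not_mem_span hw j₀ hkl⟩)
  · exact Or.inl (linearIndependent_update_of_not_mem_span hw j₀ h1)

/-- **RE-MATCH OR CONSTANT COEFFICIENTS.** With the coefficient data of `torusExtension_explicit` (in the abstract
currency: `N·a_k = Σ ar k j • D j`, `N·b_l = Σ ac l j • D j`, `D j₀ = A₀ − B₀`): either one of the re-matchings of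
`rematch_or_rigid` keeps an independent matching, or the `j₀`-coefficients are constant (`rigid_coefficients_of_mem_span`)
— the pinned character is then `(∏ d' ∏ e')^α = 1`. [folklore] -/
theorem rematch_or_constant_coefficients {n' : ℕ} (D : Fin s → V) (hw : LinearIndependent ℚ D)
    (a b : Fin n' → V) (A₀ B₀ : V) (j₀ : Fin s) (hD₀ : D j₀ = A₀ - B₀) (N : ℕ) (ar ac : Fin n' → Fin s → ℤ)
    (har : ∀ k, (N : ℚ) • a k = ∑ j, (ar k j : ℚ) • D j)
    (hac : ∀ l, (N : ℚ) • b l = ∑ j, (ac l j : ℚ) • D j) (l₀ : Fin n') :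
    LinearIndependent ℚ (Function.update D j₀ (A₀ - b l₀)) ∨
    (∃ k l, l ≠ l₀ ∧ LinearIndependent ℚ (Function.update D j₀ (a k - b l))) ∨
    (∃ k, LinearIndependent ℚ (Function.update D j₀ (a k - B₀))) ∨
    (∃ α : ℤ, (∀ k, ar k j₀ = α) ∧ (∀ l, l ≠ l₀ → ac l j₀ = α) ∧ ac l₀ j₀ = α + N) := by
  rcases rematch_or_rigid D hw a b A₀ B₀ j₀ l₀ with h | h | h | ⟨h1, h2, h3⟩
  · exact Or.inl h
  · exact Or.inr (Or.inl h)
  · exact Or.inr (Or.inr (Or.inl h))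
  · exact Or.inr (Or.inr (Or.inr
      (rigid_coefficients_of_mem_span D hw a b A₀ B₀ j₀ hD₀ N ar ac har hac l₀ h1 h2 h3)))

end Summit.ValiantsHypothesis.ValiantsHypothesis.Theorems.FreeSubtorusOrbitDimensionBound.AbsorbingSacrifice

end
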